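import Literature.Analysis.FluidPDE.RusinSverakLerayStability
import Literature.Analysis.FluidPDE.SuitableWeakPressure
import HarnessLib

/-!
# Glue for "the situation of Prop. 2.2": box bounds, distributional limits, `L^{3/2}` up to `t = 0`

Analysis/FluidPDE support file (all results proved, [folklore]; no definitions, no named facts)
for the assembly of Rusin–Šverák's weak stability of `NS(u₀)`
(`rusin_sverak_leray_weak_stability`, `RusinSverakLerayStability.lean`; J. Funct. Anal. 260
(2011) = arXiv:0911.0500, Thm. 4.2 with Lemma 4.1 and Prop. 2.2) from its printed ingredients
(`RusinSverakLerayStabilityAssembly.lean`), phrased over the tree's rendering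
`RusinSverak2011.CompactnessSituation` of "the situation of Proposition 2.2":

* `integrableOn_of_lintegral_rpow_three_halves_lt_top` — `L^{3/2}` on a set of finite measure is
  integrable there (Hölder);
* `ae_lintegral_indicator_sq_le_of_box` — the uniformly local energy bound of Lemma 4.1 on a box
  `(0, T) × B_M`, `esssup_t ∫_{B_M} |u(t)|² ≤ C`, gives the energy bound of the situation of
  Prop. 2.2 (`∫ 𝟙_K |u(t, ·)|² ≤ C` for a.e. `t ∈ ℝ`) on every `K ⊆ (0, M) × B_M`, `M ≤ T`;
* `enorm_setIntegral_inner_le_of_test`, `tendsto_setIntegral_inner_of_tendsto_lintegral_cube` —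
  **strong `L³_loc` convergence implies convergence in the sense of distributions**:
  `|∫_O ⟪w, ψ⟫| ≤ ‖ψ‖_∞ |supp ψ|^{2/3} ‖w‖_{L³(supp ψ)}`, hence `∫_O ⟪u_k, ψ⟫ → ∫_O ⟪u, ψ⟫` for
  every test field `ψ ∈ C_c^∞(O)` when `∫_K |u_k - u|³ → 0` on compacts (the hypothesis
  "`u^k` converge weakly to `u` in distributions" of Thm. 4.2 for the subsequence of Prop. 2.2);
* `ae_forall_lintegral_ball_le_of_forall_ae` — from "for every centre, for a.e. `t`" (the form
  of Jia–Šverák's Cor. 1) to "for a.e. `t`, for every centre" (Kang–Miura–Tsai's `esssup sup`) at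
  the cost of one unit of radius (countable dense set of centres);
  `exists_measurable_gauge_lintegral_eq` — an a.e.-measurable time gauge may be replaced by a
  measurable one;
* `lintegral_Ioo_prod_lt_top_of_compact_bounds` — **integrability up to `t = 0`**: a uniform
  bound `∫_{K'} f ≤ B` over the compact subsets `K'` of `(0, T) × K` gives `∫_{(0,T)×K} f ≤ B`
  (exhaustion by `[T/(j+2), T - T/(j+2)] × K` and continuity of the measure `f dz` from below);
  this turns the weak lower semicontinuity of the `L^{3/2}` norms of the renormalised pressures on
  compact subsets of the open slab into the field `IsLocalLeraySolution.pressure` of the limit.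

## Mathlib / tree search

Tree: `RusinSverak2011.CompactnessSituation` (`RusinSverakLerayStability.lean`; its invariance
under a.e. modification of the limit, `RusinSverak2011.CompactnessSituation.congr_limit_ae`, is in
`LocalLerayPressureRenormalisation.lean`), `integrable_inner_of_locallyIntegrableOn`
(`SuitableWeakPressure.lean`), `IsSpaceTimeTestOn` (`WeakSolution.lean`). Mathlib:
`eLpNorm_le_eLpNorm_mul_rpow_measure_univ`,
`enorm_integral_le_lintegral_enorm`, `tendsto_iff_edist_tendsto_0`, `ENNReal.continuous_rpow_const`,
`ENNReal.Tendsto.mul_const`, `MemLp.integrable`, `withDensity_apply'`, `Monotone.measure_iUnion`,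
`Filter.liminf_le_of_frequently_le'`.

## References

* W. Rusin, V. Šverák, J. Funct. Anal. 260 (2011) = arXiv:0911.0500, Prop. 2.2 (p. 4), Lemma 4.1
  and Thm. 4.2 (p. 7).
-/

noncomputable section

open MeasureTheory TopologicalSpace Filter Set Function Metric
open _root_.Topology
open scoped ENNReal NNReal InnerProductSpace

namespace Literature.Analysis.FluidPDE

section Situation

/-- **From `L^{3/2}` on a set of finite measure to integrability** (Hölder / Jensen).
[folklore] -/
theorem integrableOn_of_lintegral_rpow_three_halves_lt_top {S : Set (ℝ × EuclideanSpace ℝ (Fin 3))}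
    {f : ℝ × EuclideanSpace ℝ (Fin 3) → ℝ} (hf : AEStronglyMeasurable f (volume.restrict S))
    (hS : volume S ≠ ∞) (h : ∫⁻ z in S, ‖f z‖ₑ ^ (3 / 2 : ℝ) < ∞) : IntegrableOn f S volume := by
  have : IsFiniteMeasure (volume.restrict S) := isFiniteMeasure_restrict.2 hS
  have hmem : MemLp f (3 / 2 : ℝ≥0∞) (volume.restrict S) := by
    refine ⟨hf, ?_⟩
    rw [eLpNorm_eq_lintegral_rpow_enorm_toReal (by norm_num)
      (ENNReal.div_lt_top (by norm_num) (by norm_num)).ne]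
    have e : ((3 / 2 : ℝ≥0∞)).toReal = (3 / 2 : ℝ) := by
      rw [ENNReal.toReal_div]; norm_num
    rw [e]
    exact ENNReal.rpow_lt_top_of_nonneg (by positivity) h.ne
  have h32 : (1 : ℝ≥0∞) ≤ 3 / 2 :=
    (ENNReal.le_div_iff_mul_le (Or.inl (by norm_num)) (Or.inl (by norm_num))).2 (by norm_num)
  exact hmem.integrable h32

/-- **The uniform local energy of a box gives the energy bound of the situation of Prop. 2.2 on
every compact subset of the box.** [folklore] -/
theorem ae_lintegral_indicator_sq_le_of_box
    {u : ℝ → EuclideanSpace ℝ (Fin 3) → EuclideanSpace ℝ (Fin 3)}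
    {K : Set (ℝ × EuclideanSpace ℝ (Fin 3))} {M : ℕ}
    (hK : K ⊆ Ioo (0 : ℝ) M ×ˢ ball (0 : EuclideanSpace ℝ (Fin 3)) M) {C : ℝ≥0∞} {T : ℝ}
    (hMT : (M : ℝ) ≤ T)
    (h : ∀ᵐ t ∂(volume.restrict (Ioo 0 T)),
      ∫⁻ x in ball (0 : EuclideanSpace ℝ (Fin 3)) M, ‖u t x‖ₑ ^ 2 ≤ C) :
    ∀ᵐ t : ℝ, ∫⁻ x, K.indicator
      (fun z : ℝ × EuclideanSpace ℝ (Fin 3) => ‖u z.1 z.2‖ₑ ^ 2) (t, x) ≤ C := by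
  filter_upwards [(ae_restrict_iff' measurableSet_Ioo).1 h] with t ht
  by_cases htM : t ∈ Ioo (0 : ℝ) M
  · have hle : ∀ x, K.indicator (fun z : ℝ × EuclideanSpace ℝ (Fin 3) => ‖u z.1 z.2‖ₑ ^ 2) (t, x)
        ≤ (ball (0 : EuclideanSpace ℝ (Fin 3)) M).indicator (fun x => ‖u t x‖ₑ ^ 2) x := by
      intro x
      by_cases hx : (t, x) ∈ K
      · rw [indicator_of_mem hx, indicator_of_mem (hK hx).2]
      · rw [indicator_of_notMem hx]
        exact zero_le
    calc ∫⁻ x, K.indicator (fun z : ℝ × EuclideanSpace ℝ (Fin 3) => ‖u z.1 z.2‖ₑ ^ 2) (t, x)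
        ≤ ∫⁻ x, (ball (0 : EuclideanSpace ℝ (Fin 3)) M).indicator (fun x => ‖u t x‖ₑ ^ 2) x :=
          lintegral_mono hle
      _ = ∫⁻ x in ball (0 : EuclideanSpace ℝ (Fin 3)) M, ‖u t x‖ₑ ^ 2 :=
          lintegral_indicator measurableSet_ball _
      _ ≤ C := ht ⟨htM.1, htM.2.trans_le hMT⟩
  · have h0 : ∀ x, K.indicator (fun z : ℝ × EuclideanSpace ℝ (Fin 3) => ‖u z.1 z.2‖ₑ ^ 2) (t, x)
        = 0 := fun x => indicator_of_notMem (fun hx => htM (hK hx).1) _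
    simp [h0]

/-- **`L³` control of a pairing with a test field** (Hölder on the support):
`‖∫_O ⟪w, ψ⟫‖ ≤ ‖ψ‖_∞ |K_ψ|^{2/3} ‖w‖_{L³(K_ψ)}`, `K_ψ = supp ψ`. [folklore] -/
theorem enorm_setIntegral_inner_le_of_test {O : Opens (ℝ × EuclideanSpace ℝ (Fin 3))}
    {w : ℝ → EuclideanSpace ℝ (Fin 3) → EuclideanSpace ℝ (Fin 3)}
    {ψ : ℝ → EuclideanSpace ℝ (Fin 3) → EuclideanSpace ℝ (Fin 3)}
    (hw : AEStronglyMeasurable (uncurry w) (volume.restrict (tsupport (uncurry ψ))))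
    {Cψ : ℝ} (hCψ : ∀ z, ‖uncurry ψ z‖ ≤ Cψ) :
    ‖∫ z in (O : Set (ℝ × EuclideanSpace ℝ (Fin 3))), ⟪w z.1 z.2, ψ z.1 z.2⟫_ℝ‖ₑ ≤
      ENNReal.ofReal Cψ * ((∫⁻ z in tsupport (uncurry ψ), ‖w z.1 z.2‖ₑ ^ (3 : ℕ)) ^ (1 / 3 : ℝ) *
        volume (tsupport (uncurry ψ)) ^ (2 / 3 : ℝ)) := by
  set Kψ := tsupport (uncurry ψ) with hKψ
  have hψ0 : ∀ z ∉ Kψ, uncurry ψ z = 0 := fun z hz => image_eq_zero_of_notMem_tsupport hz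
  -- pointwise: `‖⟪w, ψ⟫‖ ≤ 𝟙_{Kψ} ‖w‖ Cψ`
  have hpt : ∀ z : ℝ × EuclideanSpace ℝ (Fin 3), ‖⟪w z.1 z.2, ψ z.1 z.2⟫_ℝ‖ₑ ≤
      Kψ.indicator (fun z => ‖w z.1 z.2‖ₑ * ENNReal.ofReal Cψ) z := by
    intro z
    by_cases hz : z ∈ Kψ
    · rw [indicator_of_mem hz]
      calc ‖⟪w z.1 z.2, ψ z.1 z.2⟫_ℝ‖ₑ ≤ ‖w z.1 z.2‖ₑ * ‖ψ z.1 z.2‖ₑ := by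
            rw [enorm_eq_nnnorm, enorm_eq_nnnorm, enorm_eq_nnnorm, ← ENNReal.coe_mul,
              ENNReal.coe_le_coe]
            exact nnnorm_inner_le_nnnorm _ _
        _ ≤ ‖w z.1 z.2‖ₑ * ENNReal.ofReal Cψ := by
            gcongr
            rw [← ofReal_norm]
            exact ENNReal.ofReal_le_ofReal (hCψ z)
    · have : ψ z.1 z.2 = 0 := hψ0 z hz
      simp [this, indicator_of_notMem hz]
  -- `L¹ ≤ L³ |K|^{2/3}` on the support
  have hJ : ∫⁻ z in Kψ, ‖w z.1 z.2‖ₑ ≤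
      (∫⁻ z in Kψ, ‖w z.1 z.2‖ₑ ^ (3 : ℕ)) ^ (1 / 3 : ℝ) * volume Kψ ^ (2 / 3 : ℝ) := by
    have h1 := eLpNorm_le_eLpNorm_mul_rpow_measure_univ (p := 1) (q := 3) (by norm_num) hw
    rw [eLpNorm_one_eq_lintegral_enorm, eLpNorm_eq_lintegral_rpow_enorm_toReal (by norm_num)
      (by norm_num), Measure.restrict_apply_univ] at h1
    have e3 : (3 : ℝ≥0∞).toReal = 3 := by norm_num
    have e1 : (1 : ℝ≥0∞).toReal = 1 := by norm_num
    simp only [e3, e1] at h1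
    have e4 : (1 / 1 - 1 / 3 : ℝ) = 2 / 3 := by norm_num
    rw [e4] at h1
    have e5 : ∀ z : ℝ × EuclideanSpace ℝ (Fin 3), ‖w z.1 z.2‖ₑ ^ (3 : ℝ) = ‖w z.1 z.2‖ₑ ^ (3 : ℕ) :=
      fun z => by rw [show (3 : ℝ) = ((3 : ℕ) : ℝ) by norm_num, ENNReal.rpow_natCast]
    have e6 : ∀ z : ℝ × EuclideanSpace ℝ (Fin 3), ‖uncurry w z‖ₑ = ‖w z.1 z.2‖ₑ := fun z => rfl
    simp only [e6] at h1
    simpa only [e5] using h1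
  calc ‖∫ z in (O : Set (ℝ × EuclideanSpace ℝ (Fin 3))), ⟪w z.1 z.2, ψ z.1 z.2⟫_ℝ‖ₑ
      ≤ ∫⁻ z in (O : Set (ℝ × EuclideanSpace ℝ (Fin 3))), ‖⟪w z.1 z.2, ψ z.1 z.2⟫_ℝ‖ₑ :=
        enorm_integral_le_lintegral_enorm _
    _ ≤ ∫⁻ z, ‖⟪w z.1 z.2, ψ z.1 z.2⟫_ℝ‖ₑ := lintegral_mono' Measure.restrict_le_self le_rfl
    _ ≤ ∫⁻ z, Kψ.indicator (fun z => ‖w z.1 z.2‖ₑ * ENNReal.ofReal Cψ) z := lintegral_mono hpt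
    _ = (∫⁻ z in Kψ, ‖w z.1 z.2‖ₑ) * ENNReal.ofReal Cψ := by
        rw [lintegral_indicator (isClosed_tsupport _).measurableSet,
          lintegral_mul_const' _ _ ENNReal.ofReal_ne_top]
    _ ≤ ((∫⁻ z in Kψ, ‖w z.1 z.2‖ₑ ^ (3 : ℕ)) ^ (1 / 3 : ℝ) * volume Kψ ^ (2 / 3 : ℝ)) *
          ENNReal.ofReal Cψ := by gcongr
    _ = _ := mul_comm _ _

/-- **Strong `L³_loc` convergence implies convergence in the sense of distributions**: if
`∫_K |u_k - u|³ → 0` for every compact `K ⊆ O`, then `∫_O ⟪u_k, ψ⟫ → ∫_O ⟪u, ψ⟫` for every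
smooth compactly supported field `ψ` on `O`. [folklore] -/
theorem tendsto_setIntegral_inner_of_tendsto_lintegral_cube
    {O : Opens (ℝ × EuclideanSpace ℝ (Fin 3))}
    {useq : ℕ → ℝ → EuclideanSpace ℝ (Fin 3) → EuclideanSpace ℝ (Fin 3)}
    {u : ℝ → EuclideanSpace ℝ (Fin 3) → EuclideanSpace ℝ (Fin 3)}
    (hum : ∀ k, LocallyIntegrableOn (uncurry (useq k))
      (O : Set (ℝ × EuclideanSpace ℝ (Fin 3))) volume)
    (hu : LocallyIntegrableOn (uncurry u) (O : Set (ℝ × EuclideanSpace ℝ (Fin 3))) volume)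
    (hconv : ∀ K ⊆ (O : Set (ℝ × EuclideanSpace ℝ (Fin 3))), IsCompact K →
      Tendsto (fun k => ∫⁻ z in K, ‖useq k z.1 z.2 - u z.1 z.2‖ₑ ^ (3 : ℕ)) atTop (𝓝 0))
    {ψ : ℝ → EuclideanSpace ℝ (Fin 3) → EuclideanSpace ℝ (Fin 3)} (hψ : IsSpaceTimeTestOn O ψ) :
    Tendsto (fun k => ∫ z in (O : Set (ℝ × EuclideanSpace ℝ (Fin 3))),
      ⟪useq k z.1 z.2, ψ z.1 z.2⟫_ℝ) atTop
      (𝓝 (∫ z in (O : Set (ℝ × EuclideanSpace ℝ (Fin 3))), ⟪u z.1 z.2, ψ z.1 z.2⟫_ℝ)) := by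
  set Kψ := tsupport (uncurry ψ) with hKψ
  have hKc : IsCompact Kψ := hψ.hasCompactSupport
  have hKO : Kψ ⊆ (O : Set (ℝ × EuclideanSpace ℝ (Fin 3))) := hψ.tsupport_subset
  have hψc : Continuous (uncurry ψ) := hψ.contDiff.continuous
  obtain ⟨Cψ, hCψ⟩ := hψc.bounded_above_of_compact_support hψ.hasCompactSupport
  have hψ0 : ∀ z ∉ Kψ, uncurry ψ z = 0 := fun z hz => image_eq_zero_of_notMem_tsupport hz
  have hint : ∀ w : ℝ → EuclideanSpace ℝ (Fin 3) → EuclideanSpace ℝ (Fin 3),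
      LocallyIntegrableOn (uncurry w) (O : Set (ℝ × EuclideanSpace ℝ (Fin 3))) volume →
      Integrable (fun z : ℝ × EuclideanSpace ℝ (Fin 3) => ⟪w z.1 z.2, ψ z.1 z.2⟫_ℝ) volume :=
    fun w hw => integrable_inner_of_locallyIntegrableOn hw hψc hKc hKO hψ0
  -- reduce to `∫_O ⟪useq k - u, ψ⟫ → 0`
  have key : ∀ k, (∫ z in (O : Set (ℝ × EuclideanSpace ℝ (Fin 3))), ⟪useq k z.1 z.2, ψ z.1 z.2⟫_ℝ) -
      ∫ z in (O : Set (ℝ × EuclideanSpace ℝ (Fin 3))), ⟪u z.1 z.2, ψ z.1 z.2⟫_ℝ =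
      ∫ z in (O : Set (ℝ × EuclideanSpace ℝ (Fin 3))),
        ⟪(useq k - u) z.1 z.2, ψ z.1 z.2⟫_ℝ := by
    intro k
    rw [← integral_sub (hint _ (hum k)).integrableOn (hint _ hu).integrableOn]
    refine integral_congr_ae (Eventually.of_forall fun z => ?_)
    simp only [Pi.sub_apply, inner_sub_left]
  rw [← tendsto_sub_nhds_zero_iff]
  simp_rw [key]
  rw [tendsto_iff_edist_tendsto_0]
  simp_rw [edist_zero_right]
  -- the `L³` bound on the support tends to `0`
  have hw : ∀ k, AEStronglyMeasurable (uncurry (useq k - u)) (volume.restrict Kψ) := fun k =>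
    ((hum k).integrableOn_compact_subset hKO hKc).aestronglyMeasurable.sub
      (hu.integrableOn_compact_subset hKO hKc).aestronglyMeasurable
  have hbound := fun k => enorm_setIntegral_inner_le_of_test (O := O) (hw k) hCψ
  have hvol : volume Kψ ^ (2 / 3 : ℝ) ≠ ∞ :=
    ENNReal.rpow_ne_top_of_nonneg (by norm_num) hKc.measure_lt_top.ne
  have h0 : Tendsto (fun k => ENNReal.ofReal Cψ *
      ((∫⁻ z in Kψ, ‖(useq k - u) z.1 z.2‖ₑ ^ (3 : ℕ)) ^ (1 / 3 : ℝ) * volume Kψ ^ (2 / 3 : ℝ)))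
      atTop (𝓝 0) := by
    have h1 : Tendsto (fun k => (∫⁻ z in Kψ, ‖(useq k - u) z.1 z.2‖ₑ ^ (3 : ℕ)) ^ (1 / 3 : ℝ))
        atTop (𝓝 0) := by
      have hc : Tendsto (fun a : ℝ≥0∞ => a ^ (1 / 3 : ℝ)) (𝓝 0) (𝓝 0) := by
        have := (ENNReal.continuous_rpow_const (y := (1 / 3 : ℝ))).tendsto 0
        rwa [ENNReal.zero_rpow_of_pos (show (0 : ℝ) < 1 / 3 by norm_num)] at this
      exact hc.comp (hconv Kψ hKO hKc)
    have h2 := ENNReal.Tendsto.mul_const h1 (Or.inr hvol)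
    rw [zero_mul] at h2
    have h3 := ENNReal.Tendsto.const_mul h2 (Or.inr ENNReal.ofReal_ne_top) (a := ENNReal.ofReal Cψ)
    rw [mul_zero] at h3
    exact h3
  exact tendsto_of_tendsto_of_tendsto_of_le_of_le tendsto_const_nhds h0 (fun k => zero_le) hbound

/-- **Integrability up to `t = 0` from bounds on compact subsets.** If `∫_{K'} f ≤ B < ∞` for
every compact `K' ⊆ (0, T) × K`, then `∫_{(0,T) × K} f < ∞` (exhaust `(0, T)` by the compact
intervals `[T/(j+2), T - T/(j+2)]` and use the continuity of the measure `f dz` along increasing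
unions). [folklore] -/
theorem lintegral_Ioo_prod_lt_top_of_compact_bounds {f : ℝ × EuclideanSpace ℝ (Fin 3) → ℝ≥0∞}
    {T : ℝ} {K : Set (EuclideanSpace ℝ (Fin 3))} (hK : IsCompact K) {B : ℝ≥0∞} (hB : B ≠ ∞)
    (h : ∀ K' : Set (ℝ × EuclideanSpace ℝ (Fin 3)), IsCompact K' → K' ⊆ Ioo 0 T ×ˢ K →
      ∫⁻ z in K', f z ≤ B) :
    ∫⁻ z in Ioo 0 T ×ˢ K, f z < ∞ := by
  rcases le_or_gt T 0 with hT | hT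
  · rw [Ioo_eq_empty (not_lt.2 hT), empty_prod]
    simp
  set s : ℕ → Set (ℝ × EuclideanSpace ℝ (Fin 3)) := fun j =>
    Icc (T / ((j : ℝ) + 2)) (T - T / ((j : ℝ) + 2)) ×ˢ K with hs
  have hδ : ∀ j : ℕ, 0 < T / ((j : ℝ) + 2) := fun j => div_pos hT (by positivity)
  have hmono : Monotone s := by
    intro i j hij
    have hij' : (i : ℝ) + 2 ≤ (j : ℝ) + 2 := by
      have : (i : ℝ) ≤ j := by exact_mod_cast hij
      linarith
    have hd : T / ((j : ℝ) + 2) ≤ T / ((i : ℝ) + 2) :=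
      div_le_div_of_nonneg_left hT.le (by positivity) hij'
    exact prod_mono (Icc_subset_Icc hd (by linarith)) Subset.rfl
  have hsub : ∀ j, s j ⊆ Ioo 0 T ×ˢ K := fun j =>
    prod_mono (fun t ht => ⟨(hδ j).trans_le ht.1, ht.2.trans_lt (sub_lt_self T (hδ j))⟩) Subset.rfl
  have hunion : Ioo 0 T ×ˢ K = ⋃ j, s j := by
    refine Subset.antisymm ?_ (iUnion_subset hsub)
    rintro ⟨t, x⟩ ⟨⟨ht0, htT⟩, hx⟩
    have hm : 0 < min t (T - t) := lt_min ht0 (sub_pos.2 htT)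
    obtain ⟨j, hj⟩ := exists_nat_gt (T / min t (T - t))
    have hj2 : T / ((j : ℝ) + 2) < min t (T - t) := by
      rw [div_lt_iff₀ (by positivity)]
      have h1 : T < min t (T - t) * j := (div_lt_iff₀' hm).1 hj
      nlinarith
    refine mem_iUnion.2 ⟨j, ⟨?_, ?_⟩, hx⟩
    · exact (hj2.trans_le (min_le_left _ _)).le
    · have := hj2.trans_le (min_le_right _ _)
      linarith
  rw [hunion, ← withDensity_apply' f, hmono.measure_iUnion]
  refine lt_of_le_of_lt (iSup_le fun j => ?_) hB.lt_top
  rw [withDensity_apply' f]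
  exact h (s j) (isCompact_Icc.prod hK) (hsub j)

/-- **From "for every centre, for a.e. time" to "for a.e. time, for every centre"** at the cost
of one unit of radius: if for every `x₀` the bound `∫_{B_{r+1}(x₀)} |u(t)|² ≤ B` holds for
a.e. `t ∈ I`, then for a.e. `t ∈ I` it holds on `B_r(x₀)` for *all* `x₀` simultaneously (pass to a
countable dense set of centres and use `B_r(x₀) ⊆ B_{r+1}(d)` for `dist(x₀, d) < 1`). This turns
the centre-wise bound of Jia–Šverák's Cor. 1 into the `esssup_t sup_{x₀}` form of Kang–Miura–Tsai.
[folklore] -/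
theorem ae_forall_lintegral_ball_le_of_forall_ae
    {u : ℝ → EuclideanSpace ℝ (Fin 3) → EuclideanSpace ℝ (Fin 3)} {μ : Measure ℝ} {r : ℝ}
    {B : ℝ≥0∞}
    (h : ∀ x₀ : EuclideanSpace ℝ (Fin 3), ∀ᵐ t ∂μ,
      ∫⁻ x in ball x₀ (r + 1), ‖u t x‖ₑ ^ 2 ≤ B) :
    ∀ᵐ t ∂μ, ∀ x₀ : EuclideanSpace ℝ (Fin 3), ∫⁻ x in ball x₀ r, ‖u t x‖ₑ ^ 2 ≤ B := by
  obtain ⟨D, hDc, hDd⟩ := TopologicalSpace.exists_countable_dense (EuclideanSpace ℝ (Fin 3))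
  haveI : Countable D := hDc.to_subtype
  have hD : ∀ᵐ t ∂μ, ∀ d : D,
      ∫⁻ x in ball (d : EuclideanSpace ℝ (Fin 3)) (r + 1), ‖u t x‖ₑ ^ 2 ≤ B :=
    ae_all_iff.2 fun d => h d
  filter_upwards [hD] with t ht x₀
  obtain ⟨d, hdD, hd⟩ := hDd.exists_dist_lt x₀ one_pos
  have hsub : ball x₀ r ⊆ ball d (r + 1) := ball_subset_ball' (by linarith [hd.le])
  exact (lintegral_mono_set hsub).trans (ht ⟨d, hdD⟩)

/-- **An a.e.-strongly-measurable time gauge may be replaced by a measurable one** without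
changing the renormalised pressure integral `∫∫_{(0,T) × B} |p - c(t)|^{3/2}` (the two gauges agree
for a.e. `t`, hence for a.e. `(t, x)`; `Measure.quasiMeasurePreserving_fst`). [folklore] -/
theorem exists_measurable_gauge_lintegral_eq {p : ℝ → EuclideanSpace ℝ (Fin 3) → ℝ} {c : ℝ → ℝ}
    {T : ℝ} (hc : AEStronglyMeasurable c (volume.restrict (Ioo 0 T)))
    (B : Set (EuclideanSpace ℝ (Fin 3))) :
    ∃ c' : ℝ → ℝ, Measurable c' ∧
      ∫⁻ z in Ioo 0 T ×ˢ B, ‖p z.1 z.2 - c' z.1‖ₑ ^ (3 / 2 : ℝ) =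
        ∫⁻ z in Ioo 0 T ×ˢ B, ‖p z.1 z.2 - c z.1‖ₑ ^ (3 / 2 : ℝ) := by
  refine ⟨hc.mk c, hc.stronglyMeasurable_mk.measurable, lintegral_congr_ae ?_⟩
  have h1 : (fun z : ℝ × EuclideanSpace ℝ (Fin 3) => c z.1) =ᵐ[volume.restrict (Ioo 0 T ×ˢ B)]
      fun z => hc.mk c z.1 := by
    rw [Measure.volume_eq_prod ℝ (EuclideanSpace ℝ (Fin 3)), ← Measure.prod_restrict]
    exact Measure.quasiMeasurePreserving_fst.ae_eq hc.ae_eq_mk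
  filter_upwards [h1] with z hz
  rw [hz]

end Situation

end Literature.Analysis.FluidPDE

end
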